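import Summits.SmoothPoincare4.SmoothPoincare4.Theorems.SymplecticOrigamiOrigamiFoldExistenceHelperGlueClosedForms
import Literature.Geometry.Kaehler.ManifoldFormsPullback
import Literature.Geometry.Symplectic.GromovR4StdModel
import Literature.Geometry.Symplectic.StandardEnd
import Literature.Topology.FourManifolds.EquidimensionalEmbedding
import Mathlib.Geometry.Manifold.LocalDiffeomorph

/-!
# Helper `helper_puncturedGluedForm` of line `stable-seam-host` for crux `OrigamiFoldExistence`
(item stmt-SmoothPoincare4-7844; brick R1 of the round-seam rung)

The round-seam rung applies Gromov's recognition theorem for `(ℝ⁴, ω₀)` relative to an end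
(`Literature.Geometry.Symplectic.gromov_recognitionR4_relEnd`) to a homotopy `4`-sphere `S` cut
open along a global chart ball `e : ℝ⁴ ↪ S`; it needs ONE smooth, closed, pointwise
nondegenerate `2`-form `sf` on the punctured manifold `M = S ∖ {e 0}` which over the open chart
ball `e(B̊)` is the pull-back `ψ^*ω₀` of the standard form along the coordinate at infinity
`ψ = ψt ∘ Subtype.val`.  This file builds `sf` by gluing

* `u := (J ∘ Subtype.val)^* Ω` on `P := {x | x.1 ∉ e(B̄(0, 1 - δ))}` — there `x.1` lies in the
  open set `U` on which the map `J : S → X` into the symplectic manifold `(X, Ω)` is `C^∞` with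
  bijective differential — and
* `v := (ψt ∘ Subtype.val)^* ω₀` on `Q := {x | x.1 ∈ e(B̊)}` — there `x.1 ∈ e(B̊ ∖ 0)`, where `ψt`
  is `C^∞` with bijective differential —

with the generic gluing lemma `helper_glue_closedForms` (brick R1a; Bott–Tu (1982), Prop. 2.3).
Smoothness and closedness of `u`, `v` at the points of `P`, `Q` are the pointwise pull-back
calculus of `Literature.Geometry.Kaehler.ManifoldFormsPullback` (`MForm.SmoothAt.pullback`,
`mextDeriv_pullback_apply`; Warner (1983), 2.22–2.23); `u = v` on `P ∩ Q` is the compatibility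
hypothesis on the annulus `1 - δ < ‖y‖ < 1`, transported from `T_y ℝ⁴` to `T_{e y} S` through the
surjective differential `de_y` (an equidimensional smooth embedding is a local diffeomorphism,
`Manifold.IsSmoothEmbedding.isLocalDiffeomorph_of_finrank_eq`); nondegeneracy of `u`, `v` is that
of `Ω`, `ω₀` read through the bijective differentials `dJ`, `dψt`.

## References

* R. Bott, L. W. Tu, *Differential Forms in Algebraic Topology*, GTM 82 (1982), §I.2, Prop. 2.3.
* F. W. Warner, *Foundations of Differentiable Manifolds and Lie Groups*, GTM 94 (1983), 2.22–2.23.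
* D. McDuff, D. Salamon, *Introduction to Symplectic Topology*, 3rd ed., OUP (2017), §1.1,
  Remark 4.5.2 (viii).
* M. Gromov, *Pseudo holomorphic curves in symplectic manifolds*, Invent. Math. 82 (1985), §0.3.C.
-/

noncomputable section

-- the prescribed namespace `Summit.<P>.<Sub>.…` duplicates `SmoothPoincare4` (P = Sub)
set_option linter.dupNamespace false

open scoped Manifold ContDiff Topology
open Set Filter Function Literature.Geometry.Kaehler Literature.Geometry.Symplectic

namespace Summit.SmoothPoincare4.SmoothPoincare4.Theorems.OrigamiFoldExistence.StableSeamHost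

section Generic

variable {S : Type*} [TopologicalSpace S] [ChartedSpace (EuclideanSpace ℝ (Fin 4)) S]
  {V : TopologicalSpace.Opens S}
  {E' : Type*} [NormedAddCommGroup E'] [NormedSpace ℝ E'] {H' : Type*} [TopologicalSpace H']
  {I' : ModelWithCorners ℝ E' H'} {N : Type*} [TopologicalSpace N] [ChartedSpace H' N]

/-- A `Fin 2`-indexed family is the pair of its two values. [folklore] -/
private theorem vec2_eq {α : Type*} (w : Fin 2 → α) : w = ![w 0, w 1] := by
  funext i
  fin_cases i <;> rfl

/-- Two alternating `2`-forms agreeing on all pairs `![a, b]` are equal. [folklore] -/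
private theorem twoForm_ext {F : Type*} [AddCommGroup F] [Module ℝ F] [TopologicalSpace F]
    {γ₁ γ₂ : F [⋀^Fin 2]→L[ℝ] ℝ} (h : ∀ a b, γ₁ ![a, b] = γ₂ ![a, b]) : γ₁ = γ₂ := by
  ext w
  rw [vec2_eq w]
  exact h _ _

/-- On an open submanifold `V ⊆ S` the differential of `g ∘ Subtype.val` at `x` is the
differential of `g` at `x.1`, on vectors (the inclusion has identity differential, Lee (2013),
Prop. 3.9). [folklore] -/
private theorem mfderiv_comp_subtypeVal_apply (g : S → N) (x : V)
    (hg : MDifferentiableAt (𝓡 4) I' g x.1) (a : EuclideanSpace ℝ (Fin 4)) :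
    mfderiv (𝓡 4) I' (g ∘ Subtype.val) x a = mfderiv (𝓡 4) I' g x.1 a := by
  rw [mfderiv_comp x hg
    (Literature.Geometry.Manifold.OpenSubmanifold.mdifferentiableAt_subtype_val x),
    Literature.Geometry.Manifold.OpenSubmanifold.mfderiv_subtype_val]
  rfl

/-- `((g ∘ Subtype.val)^* β)_x (a, b) = β_{g x.1} (dg a, dg b)` on an open submanifold.
[cite: WarnerGTM94, 2.22] -/
private theorem pullback_comp_subtypeVal_apply_two (β : MForm I' N ℝ 2) (g : S → N) (x : V)
    (hg : MDifferentiableAt (𝓡 4) I' g x.1) (a b : EuclideanSpace ℝ (Fin 4)) :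
    β.pullback (𝓡 4) (g ∘ Subtype.val) x ![a, b] =
      β (g x.1) ![mfderiv (𝓡 4) I' g x.1 a, mfderiv (𝓡 4) I' g x.1 b] := by
  rw [MForm.pullback_apply]
  have h : (fun i : Fin 2 => mfderiv (𝓡 4) I' (g ∘ Subtype.val) x
      ((![a, b] : Fin 2 → TangentSpace (𝓡 4) x) i)) =
      ![mfderiv (𝓡 4) I' g x.1 a, mfderiv (𝓡 4) I' g x.1 b] := by
    funext i
    fin_cases i
    · exact mfderiv_comp_subtypeVal_apply g x hg a
    · exact mfderiv_comp_subtypeVal_apply g x hg b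
  rw [h]
  rfl

/-- **Nondegeneracy pulls back through a bijective differential.**  If `β` is nondegenerate at
`g x.1` and `dg_{x.1}` is bijective, then `(g ∘ Subtype.val)^* β` is nondegenerate at the point
`x` of the open submanifold `V`. [cite: McDuffSalamon2017, §1.1 (1.1.21)] -/
private theorem pullback_comp_subtypeVal_nondegenerate {β : MForm I' N ℝ 2} {g : S → N} (x : V)
    (hβ : ∀ v : TangentSpace I' (g x.1), v ≠ 0 → ∃ w, β (g x.1) ![v, w] ≠ 0)
    (hg : MDifferentiableAt (𝓡 4) I' g x.1) (hb : Bijective (mfderiv (𝓡 4) I' g x.1))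
    (a : EuclideanSpace ℝ (Fin 4)) (ha : a ≠ 0) :
    ∃ b : EuclideanSpace ℝ (Fin 4), β.pullback (𝓡 4) (g ∘ Subtype.val) x ![a, b] ≠ 0 := by
  have hLa : mfderiv (𝓡 4) I' g x.1 a ≠ 0 := fun h0 =>
    ha (hb.1 (h0.trans (map_zero (mfderiv (𝓡 4) I' g x.1)).symm))
  obtain ⟨w', hw'⟩ := hβ _ hLa
  obtain ⟨b, hb'⟩ := hb.2 w'
  refine ⟨b, ?_⟩
  rw [pullback_comp_subtypeVal_apply_two β g x hg, hb']
  exact hw'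

variable [IsManifold (𝓡 4) ∞ S] [IsManifold I' ∞ N]

/-- **Pointwise pull-back calculus on an open submanifold.**  If `β` is a smooth form on `N` and
`g : S → N` is `C^∞` on an open set `W`, then at every point `x` of the open submanifold `V`
with `x.1 ∈ W` the form `(g ∘ Subtype.val)^* β` is smooth, and it is closed there if `β` is
closed (Warner (1983), 2.22–2.23, via `MForm.SmoothAt.pullback`, `mextDeriv_pullback_apply`).
[cite: WarnerGTM94, 2.22–2.23] -/
private theorem smoothAt_pullback_comp_subtypeVal {β : MForm I' N ℝ 2} (hβ : IsSmoothForm β)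
    {g : S → N} {W : Set S} (hW : IsOpen W) (hg : ContMDiffOn (𝓡 4) I' ∞ g W) (x : V)
    (hx : x.1 ∈ W) :
    (β.pullback (𝓡 4) (g ∘ Subtype.val)).SmoothAt x ∧
      (IsClosedForm β → mextDeriv (β.pullback (𝓡 4) (g ∘ Subtype.val)) x = 0) := by
  have hev : ∀ᶠ z in 𝓝 x, ContMDiffAt (𝓡 4) I' ∞ (g ∘ Subtype.val) z := by
    filter_upwards [(hW.preimage continuous_subtype_val).mem_nhds hx] with z hz
    exact ((hg z.1 hz).contMDiffAt (hW.mem_nhds hz)).comp z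
      (contMDiff_subtype_val (I := 𝓡 4) (n := ∞) (U := V) z)
  have hβx : β.SmoothAt ((g ∘ Subtype.val) x) := (isSmoothForm_iff_smoothAt β).1 hβ _
  refine ⟨MForm.SmoothAt.pullback hev hβx, fun hc => ?_⟩
  rw [mextDeriv_pullback_apply hev hβx]
  have h0 : mextDeriv β = 0 := hc
  rw [h0, MForm.pullback_zero]
  rfl

end Generic

/-- **The glued symplectic form on the punctured homotopy sphere.**  Let `e : ℝ⁴ → S` be a smooth
embedding of the model space into a closed smooth `4`-manifold `S`, `(X, Ω)` a closed symplectic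
`4`-manifold (`Ω` smooth, closed, pointwise nondegenerate), `J : S → X` a map which is `C^∞`
with bijective differential on an open set `U` containing the fake ball `(e(B̊))ᶜ` and the collar
`e({1 - δ < ‖y‖})`, and `ψt : S → ℝ⁴` a map which is `C^∞` with bijective differential on the
punctured chart ball `e(B̊ ∖ 0)`, compatible with `J` on the annulus:
`Ω(d(J ∘ e) v, d(J ∘ e) w) = ω₀(d(ψt ∘ e) v, d(ψt ∘ e) w)` for `1 - δ < ‖y‖ < 1`.  Then the
punctured manifold `S ∖ {e 0}` carries a smooth, closed, pointwise nondegenerate `2`-form `sf`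
which over `e(B̊)` equals `(ψt ∘ Subtype.val)^* ω₀` (gluing `(J ∘ Subtype.val)^* Ω` and
`(ψt ∘ Subtype.val)^* ω₀` by `helper_glue_closedForms`; Bott–Tu (1982), Prop. 2.3, Warner (1983),
2.22–2.23). [cite: BottTu1982Forms, Prop. 2.3] -/
theorem helper_puncturedGluedForm : ∀ (S : Type) [TopologicalSpace S] [T2Space S] [SecondCountableTopology S] [CompactSpace S] [ChartedSpace (EuclideanSpace ℝ (Fin 4)) S] [IsManifold (𝓡 4) ∞ S] (e : EuclideanSpace ℝ (Fin 4) → S) (X : Type) [TopologicalSpace X] [T2Space X] [SecondCountableTopology X] [CompactSpace X] [ChartedSpace (EuclideanSpace ℝ (Fin 4)) X] [IsManifold (𝓡 4) ∞ X] (Ω : Literature.Geometry.Kaehler.MForm (𝓡 4) X ℝ 2) (J : S → X) (U : Set S) (ψt : S → EuclideanSpace ℝ (Fin 4)) (δ : ℝ), Manifold.IsSmoothEmbedding (𝓡 4) (𝓡 4) ∞ e → (Literature.Geometry.Kaehler.IsSmoothForm Ω ∧ Literature.Geometry.Kaehler.IsClosedForm Ω ∧ ∀ x (v : TangentSpace (𝓡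 4) x), v ≠ 0 → ∃ w, Ω x ![v, w] ≠ 0) → IsOpen U → (e '' Metric.ball (0 : EuclideanSpace ℝ (Fin 4)) 1)ᶜ ⊆ U → ContMDiffOn (𝓡 4) (𝓡 4) ∞ J U → (∀ x ∈ U, Function.Bijective (mfderiv (𝓡 4) (𝓡 4) J x)) → 0 < δ → (∀ y : EuclideanSpace ℝ (Fin 4), 1 - δ < ‖y‖ → e y ∈ U) → ContMDiffOn (𝓡 4) 𝓘(ℝ, EuclideanSpace ℝ (Fin 4)) ∞ ψt (e '' (Metric.ball (0 : EuclideanSpace ℝ (Fin 4)) 1 \ {0})) → (∀ x ∈ e '' (Metric.ball (0 : EuclideanSpace ℝ (Fin 4)) 1 \ {0}), Function.Bijective (mfderiv (𝓡 4) 𝓘(ℝ, EuclideanSpace ℝ (Fin 4)) ψt x)) → (∀ y : EuclideanSpace ℝ (Fin 4), 1 - δ < ‖y‖ → ‖y‖ < 1 → ∀ v w : EuclideanSpace ℝ (Fin 4), Ω ((J ∘ e) y) ![mfderiv (𝓡 4) (𝓡 4) (J ∘ e) y v, mfderiv (𝓡 4) (𝓡 4) (J ∘ e) y w] = Literature.Geometry.Symplectic.stdSymplecticForm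 (mfderiv (𝓡 4) 𝓘(ℝ, EuclideanSpace ℝ (Fin 4)) (ψt ∘ e) y v) (mfderiv (𝓡 4) 𝓘(ℝ, EuclideanSpace ℝ (Fin 4)) (ψt ∘ e) y w)) → ∃ sf : Literature.Geometry.Kaehler.MForm (𝓡 4) (Literature.Geometry.Symplectic.punctured (e 0)) ℝ 2, Literature.Geometry.Kaehler.IsSmoothForm sf ∧ Literature.Geometry.Kaehler.IsClosedForm sf ∧ (∀ x (v : TangentSpace (𝓡 4) x), v ≠ 0 → ∃ w, sf x ![v, w] ≠ 0) ∧ (∀ x : (Literature.Geometry.Symplectic.punctured (e 0)), x.1 ∈ e '' Metric.ball (0 : EuclideanSpace ℝ (Fin 4)) 1 → ∀ v w : EuclideanSpace ℝ (Fin 4), sf x ![v, w] = Literature.Geometry.Symplectic.stdSymplecticForm (mfderiv (𝓡 4) 𝓘(ℝ, EuclideanSpace ℝ (Fin 4)) (ψt ∘ Subtype.val) x v) (mfderiv (𝓡 4) 𝓘(ℝ, EuclideanSpace ℝ (Fin 4)) (ψt ∘ Subtype.val) x w)) := by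
  intro S _ _ _ _ _ _ e X _ _ _ _ _ _ Ω J U ψt δ he hΩ hUo hUc hJ hJb hδ hcol hψ hψb hcompat
  obtain ⟨hΩs, hΩc, hΩn⟩ := hΩ
  -- facts about the chart embedding `e`
  have heo : IsOpenMap e := (he.isLocalDiffeomorph_of_finrank_eq rfl).isOpenMap
  have hec : Continuous e := he.contMDiff.continuous
  -- the punctured chart ball `W = e(B̊ ∖ 0)` is open
  have hWo : IsOpen (e '' (Metric.ball (0 : EuclideanSpace ℝ (Fin 4)) 1 \ {0})) :=
    heo _ (Metric.isOpen_ball.sdiff isClosed_singleton)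
  -- the two open pieces of `M = S ∖ {e 0}`
  set P : Set (punctured (e 0)) :=
    Subtype.val ⁻¹' (e '' Metric.closedBall (0 : EuclideanSpace ℝ (Fin 4)) (1 - δ))ᶜ with hP_def
  set Q : Set (punctured (e 0)) :=
    Subtype.val ⁻¹' (e '' Metric.ball (0 : EuclideanSpace ℝ (Fin 4)) 1) with hQ_def
  have hPo : IsOpen P :=
    (((isCompact_closedBall _ _).image hec).isClosed.isOpen_compl).preimage continuous_subtype_val
  have hQo : IsOpen Q := (heo _ Metric.isOpen_ball).preimage continuous_subtype_val
  have hPQ : P ∪ Q = univ := by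
    refine eq_univ_of_forall fun x => ?_
    by_cases hxQ : x.1 ∈ e '' Metric.ball (0 : EuclideanSpace ℝ (Fin 4)) 1
    · exact Or.inr hxQ
    · refine Or.inl fun hxP => hxQ ?_
      obtain ⟨y, hy, hyx⟩ := hxP
      exact ⟨y, Metric.closedBall_subset_ball (by linarith) hy, hyx⟩
  -- points of `P` lie over `U`, points of `Q` over `W`
  have hPU : ∀ x ∈ P, x.1 ∈ U := by
    intro x hxP
    by_cases hxQ : x.1 ∈ e '' Metric.ball (0 : EuclideanSpace ℝ (Fin 4)) 1
    · obtain ⟨y, -, hyx⟩ := hxQ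
      have hy : y ∉ Metric.closedBall (0 : EuclideanSpace ℝ (Fin 4)) (1 - δ) :=
        fun hy => hxP ⟨y, hy, hyx⟩
      rw [Metric.mem_closedBall, dist_zero_right, not_le] at hy
      rw [← hyx]
      exact hcol y hy
    · exact hUc hxQ
  have hQW : ∀ x ∈ Q, x.1 ∈ e '' (Metric.ball (0 : EuclideanSpace ℝ (Fin 4)) 1 \ {0}) := by
    intro x hxQ
    obtain ⟨y, hy, hyx⟩ := hxQ
    refine ⟨y, ⟨hy, fun hy0 => ?_⟩, hyx⟩
    rw [mem_singleton_iff] at hy0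
    exact (mem_punctured.1 x.2) (by rw [← hyx, hy0])
  -- the two local forms
  set u : MForm (𝓡 4) (punctured (e 0)) ℝ 2 := Ω.pullback (𝓡 4) (J ∘ Subtype.val) with hu_def
  set v : MForm (𝓡 4) (punctured (e 0)) ℝ 2 :=
    stdSymplecticMForm.pullback (𝓡 4) (ψt ∘ Subtype.val) with hv_def
  have hu : ∀ x ∈ P, u.SmoothAt x ∧ mextDeriv u x = 0 := fun x hx =>
    let h := smoothAt_pullback_comp_subtypeVal (V := punctured (e 0)) hΩs hUo hJ x (hPU x hx)
    ⟨h.1, h.2 hΩc⟩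
  have hv : ∀ x ∈ Q, v.SmoothAt x ∧ mextDeriv v x = 0 := fun x hx =>
    let h := smoothAt_pullback_comp_subtypeVal (V := punctured (e 0))
      isSmoothForm_stdSymplecticMForm hWo hψ x (hQW x hx)
    ⟨h.1, h.2 isClosedForm_stdSymplecticMForm⟩
  -- agreement on `P ∩ Q` (the annulus `1 - δ < ‖y‖ < 1`)
  have huv : ∀ x ∈ P ∩ Q, u x = v x := by
    rintro ⟨x₀, hx₀⟩ ⟨hxP, hxQ⟩
    obtain ⟨y, hy, hyx⟩ := hxQ
    subst hyx
    have hy2 : ‖y‖ < 1 := by simpa using hy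
    have hy1 : 1 - δ < ‖y‖ := by
      have hy' : y ∉ Metric.closedBall (0 : EuclideanSpace ℝ (Fin 4)) (1 - δ) :=
        fun hy' => hxP ⟨y, hy', rfl⟩
      rwa [Metric.mem_closedBall, dist_zero_right, not_le] at hy'
    have hy0 : y ≠ 0 := fun h0 => (mem_punctured.1 hx₀) (by rw [h0])
    have heU : e y ∈ U := hcol y hy1
    have heW : e y ∈ e '' (Metric.ball (0 : EuclideanSpace ℝ (Fin 4)) 1 \ {0}) :=
      ⟨y, ⟨hy, hy0⟩, rfl⟩
    have hJd : MDifferentiableAt (𝓡 4) (𝓡 4) J (e y) :=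
      ((hJ _ heU).contMDiffAt (hUo.mem_nhds heU)).mdifferentiableAt (by simp)
    have hψd : MDifferentiableAt (𝓡 4) 𝓘(ℝ, EuclideanSpace ℝ (Fin 4)) ψt (e y) :=
      ((hψ _ heW).contMDiffAt (hWo.mem_nhds heW)).mdifferentiableAt (by simp)
    have hed : MDifferentiableAt (𝓡 4) (𝓡 4) e y := (he.contMDiff y).mdifferentiableAt (by simp)
    have hsurj : Surjective (mfderiv (𝓡 4) (𝓡 4) e y) :=
      ((he.isLocalDiffeomorph_of_finrank_eq rfl y).mfderivToContinuousLinearEquiv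
        (by simp)).surjective
    have hJe : ∀ b, mfderiv (𝓡 4) (𝓡 4) J (e y) (mfderiv (𝓡 4) (𝓡 4) e y b) =
        mfderiv (𝓡 4) (𝓡 4) (J ∘ e) y b := fun b => by
      rw [mfderiv_comp y hJd hed]; rfl
    have hψe : ∀ b, mfderiv (𝓡 4) 𝓘(ℝ, EuclideanSpace ℝ (Fin 4)) ψt (e y)
        (mfderiv (𝓡 4) (𝓡 4) e y b) =
        mfderiv (𝓡 4) 𝓘(ℝ, EuclideanSpace ℝ (Fin 4)) (ψt ∘ e) y b := fun b => by
      rw [mfderiv_comp y hψd hed]; rfl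
    refine twoForm_ext fun p q => ?_
    obtain ⟨a, rfl⟩ := hsurj p
    obtain ⟨b, rfl⟩ := hsurj q
    rw [hu_def, hv_def, pullback_comp_subtypeVal_apply_two Ω J _ hJd,
      pullback_comp_subtypeVal_apply_two stdSymplecticMForm ψt _ hψd, stdSymplecticMForm_apply]
    show Ω (J (e y)) ![mfderiv (𝓡 4) (𝓡 4) J (e y) (mfderiv (𝓡 4) (𝓡 4) e y a),
        mfderiv (𝓡 4) (𝓡 4) J (e y) (mfderiv (𝓡 4) (𝓡 4) e y b)] =
      stdSymplecticForm
        (mfderiv (𝓡 4) 𝓘(ℝ, EuclideanSpace ℝ (Fin 4)) ψt (e y) (mfderiv (𝓡 4) (𝓡 4) e y a))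
        (mfderiv (𝓡 4) 𝓘(ℝ, EuclideanSpace ℝ (Fin 4)) ψt (e y) (mfderiv (𝓡 4) (𝓡 4) e y b))
    rw [hJe a, hJe b, hψe a, hψe b]
    exact hcompat y hy1 hy2 a b
  -- glue
  obtain ⟨s, hs, hsc, hsP, hsQ⟩ := helper_glue_closedForms (punctured (e 0)) P Q u v hPo hQo hPQ
    (fun x hx => (hu x hx).1) (fun x hx => (hv x hx).1) (fun x hx => (hu x hx).2)
    (fun x hx => (hv x hx).2) huv
  have hcov : ∀ x : punctured (e 0), x ∈ P ∨ x ∈ Q := fun x => by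
    have hx : x ∈ P ∪ Q := hPQ ▸ mem_univ x
    exact hx
  refine ⟨s, hs, hsc, fun x a ha => ?_, fun x hx a b => ?_⟩
  · -- nondegeneracy, piece by piece
    rcases hcov x with hx | hx
    · rw [hsP x hx, hu_def]
      have hxU := hPU x hx
      exact pullback_comp_subtypeVal_nondegenerate x (hΩn (J x.1))
        (((hJ _ hxU).contMDiffAt (hUo.mem_nhds hxU)).mdifferentiableAt (by simp)) (hJb _ hxU) a ha
    · rw [hsQ x hx, hv_def]
      have hxW := hQW x hx
      exact pullback_comp_subtypeVal_nondegenerate x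
        (fun v hv => stdSymplecticMForm_nondegenerate (ψt x.1) v hv)
        (((hψ _ hxW).contMDiffAt (hWo.mem_nhds hxW)).mdifferentiableAt (by simp)) (hψb _ hxW) a ha
  · -- over the chart ball the glued form is `(ψt ∘ Subtype.val)^* ω₀`
    rw [hsQ x hx, hv_def]
    exact stdSymplecticMForm_pullback_apply (ψt ∘ Subtype.val) x a b

end Summit.SmoothPoincare4.SmoothPoincare4.Theorems.OrigamiFoldExistence.StableSeamHost

end
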